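import Summits.ResolutionOfSingularities.ResolutionOfSingularities.Theorems.FrobeniusLadderFInjectiveMacaulayficationPointFixableOfCert
import Summits.ResolutionOfSingularities.ResolutionOfSingularities.Theorems.FrobeniusLadderFInjectiveMacaulayficationKLocCellRange
import Summits.ResolutionOfSingularities.ResolutionOfSingularities.Theorems.FrobeniusLadderFInjectiveMacaulayficationKLocCellSound
import Summits.ResolutionOfSingularities.ResolutionOfSingularities.Theorems.FrobeniusLadderFInjectiveMacaulayficationQuotientOriginMaximal
import HarnessLib

/-!
# THE ROAD-B FRAME: `PFix` at the origin of a hypersurface specimen from fan data + KERNEL CELL CHECKS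
# (crux `FInjectiveMacaulayfication`, road B «K-loc certificate → `ciCertificates` → `pointFixable_of_ciCert`»; res-L1-w45a-plan-1 R12.29 (c) /
# R12.30 (c) «stub-1 := FRAME»; seat res-L1-w45a-stub-1)

Support file for crux stmt-ResolutionOfSingularities-15315 (`FrobeniusLadder.FInjectiveMacaulayfication`), chain w45a. [OURS · L1 W4.5a] — NOT a
statement of the manuscript [claim: Hironaka2017]; AI-written, weaker than expert review.

The frame of every road-B HYPERSURFACE instance (`T₁₁/7`: n = 4, t = 87; `T⁽⁴⁾/7`: n = 5, t = 537): res-L1-w45a-stub-3's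
`PointFixableOfCert.pointFixable_of_ciCert` at `r = 1`, `J = univ`, `Fs = ![f]`, strict transforms `gs c = ![KLocCellKit.evalL k (G c)]`
(res-L1-w45a-stub-6's term-list currency), with the naive-chart hypothesis `hon'` DISCHARGED chart by chart by
`KLocCellRange.honQuot_of_kLocCells_range` (stub-1) ∘ `KLocCellKit.klocCells_of_check` (stub-6: ONE `decide +kernel` per chart), the
`hJ` trivial (`J = univ`), the origin maximal by `QuotientOriginMaximal.isMaximal_span_range_mk_X` (`f(0) = 0`). What remains as
INPUT is exactly what the generated modules deliver BY NAME: the fan-side binders of `ciCertificates`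
(`hprim hAJ hcov hV haA hgen hge hθF hunit hv`, res-L1-w45a-stub-5's `T11Char7Fan`), `g_c ≠ 0`, `Y_i ∤ g_c`, and per chart the
Boolean certificate `KLocCellKit.checkKs p (G c) (cells c) = true` plus the strata COVER of the cell list. The conclusion is stated in
the `h0` shape of the specimen doors (`SpecimenDoor` / `T11SpecimenDoor`, up to the model transport of res-L1-w45a-stub-2's
`PointFixableTransport`): `∀ b, b.asIdeal = (x̄ᵢ) → PFix_p(𝒪_{X,b})`.

* `hon_of_kernelChecks` / `originPointFixable_of_kernelChecks` — from per-chart KERNEL CHECKS `checkKs = true` + cover;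
* `originPointFixable_of_hon` — **THE FRAME** from the fan binders + per-chart `hon'`;
* `hon_of_cells` / `originPointFixable_of_cells` — from the per-chart CELL PACKAGES `chart<c>_cells` (R12.34 PHASE 1);
* `evalL_eq_of_perm` / `cells_of_eq` / `cells_of_perm` / `cells_transport` — a cell package transports along a permutation of the
  term list and an equality of strata lists (side-goals by `decide +kernel`; the per-chart form of the instance files).

No definitions, no named facts; glue. [folklore]
-/

-- single-problem summit: the doubled namespace component is forced
set_option linter.dupNamespace false
noncomputable section

open AlgebraicGeometry MvPolynomial

namespace Summit.ResolutionOfSingularities.ResolutionOfSingularities.Theorems.FInjectiveMacaulayfication.RoadBFrame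

open Summit.ResolutionOfSingularities.ResolutionOfSingularities.Theorems.FInjectiveMacaulayfication

/-- **`hon'` OF EVERY CHART FROM THE KERNEL CHECKS**: for charts `c : Fin t` with matrices `V c`, strict transforms
`g_c = KLocCellKit.evalL k (G c)` (`g_c ≠ 0`, no variable divides `g_c`), cell lists `cells c` passing `KLocCellKit.checkKs p` and
covering every orthant over the centre (`J = univ`), the naive-chart hypothesis `hon'` of `pointFixable_of_ciCert` /
`ciCertificates` at `r = 1`, `gs c = ![g_c]`. [folklore; cite: Fedder1983, Prop. 1.7 and Thm. 1.12] -/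
theorem hon_of_kernelChecks (p : ℕ) [Fact p.Prime] (k : Type) [Field k] [CharP k p] (n t : ℕ)
    (V : Fin t → Matrix (Fin n) (Fin n) ℕ) (G : Fin t → List (ℤ × (Fin n → ℕ)))
    (hg0 : ∀ c : Fin t, KLocCellKit.evalL k (G c) ≠ 0)
    (hX : ∀ (c : Fin t) (i : Fin n), ¬ (X i : MvPolynomial (Fin n) k) ∣ KLocCellKit.evalL k (G c))
    (cells : Fin t → List (Finset (Fin n) × List ((Fin n → ℕ) × List (ℤ × (Fin n → ℕ))) ×
      (Fin n → List (ℤ × (Fin n → ℕ))) × List (ℤ × (Fin n → ℕ))))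
    (hcheck : ∀ c : Fin t, KLocCellKit.checkKs p (G c) (cells c) = true)
    (hSS : ∀ (c : Fin t) (T : Finset (Fin n)), (∀ j ∈ (Finset.univ : Finset (Fin n)), ∃ i ∈ T, 0 < V c i j) →
      ∃ S ∈ (cells c).map Prod.fst, S ⊆ T) :
    ∀ (c : Fin t) (Q' : Ideal (MvPolynomial (Fin n) k ⧸ Ideal.span (Set.range
        ((fun c : Fin t => (![KLocCellKit.evalL k (G c)] : Fin 1 → MvPolynomial (Fin n) k)) c)))) [Q'.IsMaximal],
      (∀ j ∈ (Finset.univ : Finset (Fin n)), Ideal.Quotient.mk (Ideal.span (Set.range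
          ((fun c : Fin t => (![KLocCellKit.evalL k (G c)] : Fin 1 → MvPolynomial (Fin n) k)) c)))
        (aeval (fun j : Fin n => ∏ i : Fin n, (X i : MvPolynomial (Fin n) k) ^ V c i j) (X j : MvPolynomial (Fin n) k)) ∈ Q') →
        (∀ i : Fin n, (X i : MvPolynomial (Fin n) k) ∈ Q'.comap (Ideal.Quotient.mk (Ideal.span (Set.range
            ((fun c : Fin t => (![KLocCellKit.evalL k (G c)] : Fin 1 → MvPolynomial (Fin n) k)) c)))) →
          IsSMulRegular (Localization.AtPrime (Q'.comap (Ideal.Quotient.mk (Ideal.span (Set.range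
              ((fun c : Fin t => (![KLocCellKit.evalL k (G c)] : Fin 1 → MvPolynomial (Fin n) k)) c))))) ⧸
              (Ideal.span (Set.range ((fun c : Fin t => (![KLocCellKit.evalL k (G c)] : Fin 1 → MvPolynomial (Fin n) k)) c))).map
                (algebraMap (MvPolynomial (Fin n) k)
                (Localization.AtPrime (Q'.comap (Ideal.Quotient.mk (Ideal.span (Set.range
                  ((fun c : Fin t => (![KLocCellKit.evalL k (G c)] : Fin 1 → MvPolynomial (Fin n) k)) c))))))))
            (algebraMap (MvPolynomial (Fin n) k)
              (Localization.AtPrime (Q'.comap (Ideal.Quotient.mk (Ideal.span (Set.range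
                ((fun c : Fin t => (![KLocCellKit.evalL k (G c)] : Fin 1 → MvPolynomial (Fin n) k)) c)))))) (X i))) ∧
        ∀ dd : ℕ, ringKrullDim (Localization.AtPrime Q') = dd → ∀ s : Fin dd → Localization.AtPrime Q',
          (Ideal.span (Set.range s)).radical.IsMaximal →
            RingTheory.Sequence.IsWeaklyRegular (Localization.AtPrime Q') (List.ofFn s) ∧
            ∀ y : Localization.AtPrime Q', (∃ e : ℕ, y ^ p ^ e ∈ Ideal.span
              ((fun z : Localization.AtPrime Q' => z ^ p ^ e) ''
                (Ideal.span (Set.range s) : Set (Localization.AtPrime Q')))) → y ∈ Ideal.span (Set.range s) := by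
  intro c
  exact KLocCellRange.honQuot_of_kLocCells_range p k n Finset.univ (V c) ![KLocCellKit.evalL k (G c)] (hg0 c) (hX c)
    ((cells c).map Prod.fst) (hSS c) (KLocCellKit.klocCells_of_check k p (G c) (cells c) (hcheck c))

/-- **THE ROAD-B FRAME, `hon'` form.** For a hypersurface `X = V(f) ⊆ 𝔸ⁿ_k` through the origin (`f(0) = 0`, `(f)` prime, no `x̄ᵥ = 0`), the fan-side
binders of `CICertificates.ciCertificates` for a monomial centre `I_A` supported at the origin (`J = univ`) with `t > 0` unimodular
charts (`hprim hAJ hcov hV haA hgen hge`), strict transforms `θ_{V c} f = Y^{d c} · g_c` with `g_c = KLocCellKit.evalL k (G c)`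
(`hθF hunit`), vertices in the centre (`hv`), and the per-chart naive-quotient clause `hon'` (the FINISHED per-chart theorems
`chart<c>_hon` of the generated cells modules, build spec R12.32a S4) ⟹ the origin of `X` is POINT-FIXABLE:
`∀ b, b.asIdeal = (x̄₁, …, x̄ₙ) → PFix_p(𝒪_{X,b})` (the `h0` shape of the specimen doors, hypersurface model). [folklore] -/
theorem originPointFixable_of_hon (p : ℕ) [Fact p.Prime] (k : Type) [Field k] [CharP k p] (n t : ℕ) (ht : 0 < t)
    (A : Finset (Fin n →₀ ℕ)) (hprim : ∀ j ∈ (Finset.univ : Finset (Fin n)), ∃ N : ℕ, Finsupp.single j N ∈ A)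
    (hAJ : ∀ a ∈ A, ∃ j ∈ (Finset.univ : Finset (Fin n)), 0 < a j)
    (m : Fin t → (Fin n →₀ ℕ))
    (hcov : ∀ a ∈ A, ∃ (c : Fin t) (K : ℕ), 1 ≤ K ∧ ∃ y ∈ (Ideal.span ((fun b : Fin n →₀ ℕ =>
        (MvPolynomial.monomial b (1 : k) : MvPolynomial (Fin n) k)) '' (A : Set (Fin n →₀ ℕ)))) ^ (K - 1),
      (MvPolynomial.monomial a (1 : k) : MvPolynomial (Fin n) k) ^ K = MvPolynomial.monomial (m c) 1 * y)
    (V : Fin t → Matrix (Fin n) (Fin n) ℕ) (hV : ∀ c, IsUnit ((V c).map (Nat.cast : ℕ → ℤ)).det)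
    (a : Fin t → Fin n → (Fin n →₀ ℕ)) (haA : ∀ c i, a c i ∈ A)
    (hgen : ∀ (c : Fin t) (i : Fin n), (Finsupp.equivFunOnFinite.symm ((V c).mulVec ⇑(a c i)) : Fin n →₀ ℕ) =
      Finsupp.equivFunOnFinite.symm ((V c).mulVec ⇑(m c)) + Finsupp.single i 1)
    (hge : ∀ (c : Fin t), ∀ e ∈ A, (Finsupp.equivFunOnFinite.symm ((V c).mulVec ⇑(m c)) : Fin n →₀ ℕ) ≤
      Finsupp.equivFunOnFinite.symm ((V c).mulVec ⇑e))
    (f : MvPolynomial (Fin n) k) (hf0 : constantCoeff f = 0)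
    (hprime : (Ideal.span (Set.range (![f] : Fin 1 → MvPolynomial (Fin n) k))).IsPrime)
    (hXne : ∀ v : Fin n, Ideal.Quotient.mk (Ideal.span (Set.range (![f] : Fin 1 → MvPolynomial (Fin n) k))) (MvPolynomial.X v) ≠ 0)
    (G : Fin t → List (ℤ × (Fin n → ℕ))) (d : Fin t → Fin 1 → (Fin n →₀ ℕ))
    (hθF : ∀ c : Fin t, aeval (fun j : Fin n => ∏ i : Fin n, (X i : MvPolynomial (Fin n) k) ^ V c i j) f =
      monomial (d c 0) (1 : k) * KLocCellKit.evalL k (G c))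
    (hunit : ∀ (c : Fin t) (l : Fin 1), ∃ (N : ℕ) (r' : Fin n →₀ ℕ), N • m c = ∑ j : Fin n, d c l j • a c j + r')
    (hv : ∀ c : Fin t, Ideal.Quotient.mk (Ideal.span (Set.range (![f] : Fin 1 → MvPolynomial (Fin n) k))) (monomial (m c) (1 : k)) ∈
      (Ideal.span ((fun e : Fin n →₀ ℕ => Ideal.Quotient.mk (Ideal.span (Set.range (![f] : Fin 1 → MvPolynomial (Fin n) k)))
        (monomial e (1 : k))) '' (A : Set (Fin n →₀ ℕ)))))
    (hon :
    ∀ (c : Fin t) (Q' : Ideal (MvPolynomial (Fin n) k ⧸ Ideal.span (Set.range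
        ((fun c : Fin t => (![KLocCellKit.evalL k (G c)] : Fin 1 → MvPolynomial (Fin n) k)) c)))) [Q'.IsMaximal],
      (∀ j ∈ (Finset.univ : Finset (Fin n)), Ideal.Quotient.mk (Ideal.span (Set.range
          ((fun c : Fin t => (![KLocCellKit.evalL k (G c)] : Fin 1 → MvPolynomial (Fin n) k)) c)))
        (aeval (fun j : Fin n => ∏ i : Fin n, (X i : MvPolynomial (Fin n) k) ^ V c i j) (X j : MvPolynomial (Fin n) k)) ∈ Q') →
        (∀ i : Fin n, (X i : MvPolynomial (Fin n) k) ∈ Q'.comap (Ideal.Quotient.mk (Ideal.span (Set.range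
            ((fun c : Fin t => (![KLocCellKit.evalL k (G c)] : Fin 1 → MvPolynomial (Fin n) k)) c)))) →
          IsSMulRegular (Localization.AtPrime (Q'.comap (Ideal.Quotient.mk (Ideal.span (Set.range
              ((fun c : Fin t => (![KLocCellKit.evalL k (G c)] : Fin 1 → MvPolynomial (Fin n) k)) c))))) ⧸
              (Ideal.span (Set.range ((fun c : Fin t => (![KLocCellKit.evalL k (G c)] : Fin 1 → MvPolynomial (Fin n) k)) c))).map
                (algebraMap (MvPolynomial (Fin n) k)
                (Localization.AtPrime (Q'.comap (Ideal.Quotient.mk (Ideal.span (Set.range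
                  ((fun c : Fin t => (![KLocCellKit.evalL k (G c)] : Fin 1 → MvPolynomial (Fin n) k)) c))))))))
            (algebraMap (MvPolynomial (Fin n) k)
              (Localization.AtPrime (Q'.comap (Ideal.Quotient.mk (Ideal.span (Set.range
                ((fun c : Fin t => (![KLocCellKit.evalL k (G c)] : Fin 1 → MvPolynomial (Fin n) k)) c)))))) (X i))) ∧
        ∀ dd : ℕ, ringKrullDim (Localization.AtPrime Q') = dd → ∀ s : Fin dd → Localization.AtPrime Q',
          (Ideal.span (Set.range s)).radical.IsMaximal →
            RingTheory.Sequence.IsWeaklyRegular (Localization.AtPrime Q') (List.ofFn s) ∧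
            ∀ y : Localization.AtPrime Q', (∃ e : ℕ, y ^ p ^ e ∈ Ideal.span
              ((fun z : Localization.AtPrime Q' => z ^ p ^ e) ''
                (Ideal.span (Set.range s) : Set (Localization.AtPrime Q')))) → y ∈ Ideal.span (Set.range s)) :
    ∀ b : Spec (.of (MvPolynomial (Fin n) k ⧸ Ideal.span (Set.range (![f] : Fin 1 → MvPolynomial (Fin n) k)))),
      b.asIdeal = Ideal.span (Set.range fun j : Fin n =>
        Ideal.Quotient.mk (Ideal.span (Set.range (![f] : Fin 1 → MvPolynomial (Fin n) k))) (X j)) →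
      ∃ (nc : ℕ) (c : Fin nc → (Spec (.of (MvPolynomial (Fin n) k ⧸ Ideal.span (Set.range (![f] : Fin 1 → MvPolynomial (Fin n) k))))).presheaf.stalk b),
        Ideal.span (Set.range c) ≠ ⊥ ∧ (Ideal.span (Set.range c)).radical =
          IsLocalRing.maximalIdeal ((Spec (.of (MvPolynomial (Fin n) k ⧸ Ideal.span (Set.range (![f] : Fin 1 → MvPolynomial (Fin n) k))))).presheaf.stalk b) ∧
        ∀ (j : Fin nc) (𝔔 : PrimeSpectrum (Literature.AlgebraicGeometry.Resolution.blowupAlgebra (Ideal.span (Set.range c)) (c j))),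
          𝔔.asIdeal.comap (algebraMap ((Spec (.of (MvPolynomial (Fin n) k ⧸ Ideal.span (Set.range (![f] : Fin 1 → MvPolynomial (Fin n) k))))).presheaf.stalk b)
            (Literature.AlgebraicGeometry.Resolution.blowupAlgebra (Ideal.span (Set.range c)) (c j))) =
            IsLocalRing.maximalIdeal ((Spec (.of (MvPolynomial (Fin n) k ⧸ Ideal.span (Set.range (![f] : Fin 1 → MvPolynomial (Fin n) k))))).presheaf.stalk b) →
          IsDomain (Localization.AtPrime 𝔔.asIdeal) ∧ ∀ dd : ℕ, ringKrullDim (Localization.AtPrime 𝔔.asIdeal) = dd →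
            ∀ s : Fin dd → Localization.AtPrime 𝔔.asIdeal, (Ideal.span (Set.range s)).radical.IsMaximal →
              RingTheory.Sequence.IsWeaklyRegular (Localization.AtPrime 𝔔.asIdeal) (List.ofFn s) ∧
              ∀ y : Localization.AtPrime 𝔔.asIdeal, (∃ e : ℕ, y ^ p ^ e ∈ Ideal.span
                ((fun z : Localization.AtPrime 𝔔.asIdeal => z ^ p ^ e) '' (Ideal.span (Set.range s) : Set (Localization.AtPrime 𝔔.asIdeal)))) →
                y ∈ Ideal.span (Set.range s) := by
  have h𝔪 := QuotientOriginMaximal.isMaximal_span_range_mk_X k (![f] : Fin 1 → MvPolynomial (Fin n) k) (fun l => by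
    fin_cases l; exact hf0)
  rintro ⟨I, hI⟩ hb
  change I = _ at hb
  subst hb
  have hθF' : ∀ (c : Fin t) (l : Fin 1), aeval (fun j : Fin n => ∏ i : Fin n, (X i : MvPolynomial (Fin n) k) ^ V c i j)
      ((![f] : Fin 1 → MvPolynomial (Fin n) k) l) =
      monomial (d c l) (1 : k) * (fun c : Fin t => (![KLocCellKit.evalL k (G c)] : Fin 1 → MvPolynomial (Fin n) k)) c l := by
    intro c l
    fin_cases l
    exact hθF c
  have hJ : ∀ (P : Ideal (MvPolynomial (Fin n) k ⧸ Ideal.span (Set.range (![f] : Fin 1 → MvPolynomial (Fin n) k)))) [P.IsPrime],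
      (∀ j ∈ (Finset.univ : Finset (Fin n)), Ideal.Quotient.mk (Ideal.span (Set.range (![f] : Fin 1 → MvPolynomial (Fin n) k)))
        (MvPolynomial.X j) ∈ P) →
      ∀ i : Fin n, Ideal.Quotient.mk (Ideal.span (Set.range (![f] : Fin 1 → MvPolynomial (Fin n) k))) (MvPolynomial.X i) ∈ P :=
    fun P _ h i => h i (Finset.mem_univ i)
  exact PointFixableOfCert.pointFixable_of_ciCert p k n Finset.univ A hprim hAJ t ht m hcov V hV a haA hgen hge 1 ![f] hprime hXne
    (fun c : Fin t => (![KLocCellKit.evalL k (G c)] : Fin 1 → MvPolynomial (Fin n) k)) d hθF' hunit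
    hon hv hJ h𝔪

/-- **THE ROAD-B FRAME, kernel-check form.** For a hypersurface `X = V(f) ⊆ 𝔸ⁿ_k` through the origin (`f(0) = 0`, `(f)` prime, no `x̄ᵥ = 0`), the fan-side
binders of `CICertificates.ciCertificates` for a monomial centre `I_A` supported at the origin (`J = univ`) with `t > 0` unimodular
charts (`hprim hAJ hcov hV haA hgen hge`), strict transforms `θ_{V c} f = Y^{d c} · g_c` with `g_c = KLocCellKit.evalL k (G c)`
(`hθF hunit`, `g_c ≠ 0`, `Y_i ∤ g_c`), vertices in the centre (`hv`), and per chart a PASSING KERNEL CHECK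
`KLocCellKit.checkKs p (G c) (cells c) = true` whose strata cover every orthant over the centre ⟹ the origin of `X` is POINT-FIXABLE:
`∀ b, b.asIdeal = (x̄₁, …, x̄ₙ) → PFix_p(𝒪_{X,b})` (the `h0` shape of the specimen doors, hypersurface model). [folklore] -/
theorem originPointFixable_of_kernelChecks (p : ℕ) [Fact p.Prime] (k : Type) [Field k] [CharP k p] (n t : ℕ) (ht : 0 < t)
    (A : Finset (Fin n →₀ ℕ)) (hprim : ∀ j ∈ (Finset.univ : Finset (Fin n)), ∃ N : ℕ, Finsupp.single j N ∈ A)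
    (hAJ : ∀ a ∈ A, ∃ j ∈ (Finset.univ : Finset (Fin n)), 0 < a j)
    (m : Fin t → (Fin n →₀ ℕ))
    (hcov : ∀ a ∈ A, ∃ (c : Fin t) (K : ℕ), 1 ≤ K ∧ ∃ y ∈ (Ideal.span ((fun b : Fin n →₀ ℕ =>
        (MvPolynomial.monomial b (1 : k) : MvPolynomial (Fin n) k)) '' (A : Set (Fin n →₀ ℕ)))) ^ (K - 1),
      (MvPolynomial.monomial a (1 : k) : MvPolynomial (Fin n) k) ^ K = MvPolynomial.monomial (m c) 1 * y)
    (V : Fin t → Matrix (Fin n) (Fin n) ℕ) (hV : ∀ c, IsUnit ((V c).map (Nat.cast : ℕ → ℤ)).det)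
    (a : Fin t → Fin n → (Fin n →₀ ℕ)) (haA : ∀ c i, a c i ∈ A)
    (hgen : ∀ (c : Fin t) (i : Fin n), (Finsupp.equivFunOnFinite.symm ((V c).mulVec ⇑(a c i)) : Fin n →₀ ℕ) =
      Finsupp.equivFunOnFinite.symm ((V c).mulVec ⇑(m c)) + Finsupp.single i 1)
    (hge : ∀ (c : Fin t), ∀ e ∈ A, (Finsupp.equivFunOnFinite.symm ((V c).mulVec ⇑(m c)) : Fin n →₀ ℕ) ≤
      Finsupp.equivFunOnFinite.symm ((V c).mulVec ⇑e))
    (f : MvPolynomial (Fin n) k) (hf0 : constantCoeff f = 0)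
    (hprime : (Ideal.span (Set.range (![f] : Fin 1 → MvPolynomial (Fin n) k))).IsPrime)
    (hXne : ∀ v : Fin n, Ideal.Quotient.mk (Ideal.span (Set.range (![f] : Fin 1 → MvPolynomial (Fin n) k))) (MvPolynomial.X v) ≠ 0)
    (G : Fin t → List (ℤ × (Fin n → ℕ))) (d : Fin t → Fin 1 → (Fin n →₀ ℕ))
    (hθF : ∀ c : Fin t, aeval (fun j : Fin n => ∏ i : Fin n, (X i : MvPolynomial (Fin n) k) ^ V c i j) f =
      monomial (d c 0) (1 : k) * KLocCellKit.evalL k (G c))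
    (hunit : ∀ (c : Fin t) (l : Fin 1), ∃ (N : ℕ) (r' : Fin n →₀ ℕ), N • m c = ∑ j : Fin n, d c l j • a c j + r')
    (hv : ∀ c : Fin t, Ideal.Quotient.mk (Ideal.span (Set.range (![f] : Fin 1 → MvPolynomial (Fin n) k))) (monomial (m c) (1 : k)) ∈
      (Ideal.span ((fun e : Fin n →₀ ℕ => Ideal.Quotient.mk (Ideal.span (Set.range (![f] : Fin 1 → MvPolynomial (Fin n) k)))
        (monomial e (1 : k))) '' (A : Set (Fin n →₀ ℕ)))))
    (hg0 : ∀ c : Fin t, KLocCellKit.evalL k (G c) ≠ 0)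
    (hX : ∀ (c : Fin t) (i : Fin n), ¬ (X i : MvPolynomial (Fin n) k) ∣ KLocCellKit.evalL k (G c))
    (cells : Fin t → List (Finset (Fin n) × List ((Fin n → ℕ) × List (ℤ × (Fin n → ℕ))) ×
      (Fin n → List (ℤ × (Fin n → ℕ))) × List (ℤ × (Fin n → ℕ))))
    (hcheck : ∀ c : Fin t, KLocCellKit.checkKs p (G c) (cells c) = true)
    (hSS : ∀ (c : Fin t) (T : Finset (Fin n)), (∀ j ∈ (Finset.univ : Finset (Fin n)), ∃ i ∈ T, 0 < V c i j) →
      ∃ S ∈ (cells c).map Prod.fst, S ⊆ T) :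
    ∀ b : Spec (.of (MvPolynomial (Fin n) k ⧸ Ideal.span (Set.range (![f] : Fin 1 → MvPolynomial (Fin n) k)))),
      b.asIdeal = Ideal.span (Set.range fun j : Fin n =>
        Ideal.Quotient.mk (Ideal.span (Set.range (![f] : Fin 1 → MvPolynomial (Fin n) k))) (X j)) →
      ∃ (nc : ℕ) (c : Fin nc → (Spec (.of (MvPolynomial (Fin n) k ⧸ Ideal.span (Set.range (![f] : Fin 1 → MvPolynomial (Fin n) k))))).presheaf.stalk b),
        Ideal.span (Set.range c) ≠ ⊥ ∧ (Ideal.span (Set.range c)).radical =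
          IsLocalRing.maximalIdeal ((Spec (.of (MvPolynomial (Fin n) k ⧸ Ideal.span (Set.range (![f] : Fin 1 → MvPolynomial (Fin n) k))))).presheaf.stalk b) ∧
        ∀ (j : Fin nc) (𝔔 : PrimeSpectrum (Literature.AlgebraicGeometry.Resolution.blowupAlgebra (Ideal.span (Set.range c)) (c j))),
          𝔔.asIdeal.comap (algebraMap ((Spec (.of (MvPolynomial (Fin n) k ⧸ Ideal.span (Set.range (![f] : Fin 1 → MvPolynomial (Fin n) k))))).presheaf.stalk b)
            (Literature.AlgebraicGeometry.Resolution.blowupAlgebra (Ideal.span (Set.range c)) (c j))) =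
            IsLocalRing.maximalIdeal ((Spec (.of (MvPolynomial (Fin n) k ⧸ Ideal.span (Set.range (![f] : Fin 1 → MvPolynomial (Fin n) k))))).presheaf.stalk b) →
          IsDomain (Localization.AtPrime 𝔔.asIdeal) ∧ ∀ dd : ℕ, ringKrullDim (Localization.AtPrime 𝔔.asIdeal) = dd →
            ∀ s : Fin dd → Localization.AtPrime 𝔔.asIdeal, (Ideal.span (Set.range s)).radical.IsMaximal →
              RingTheory.Sequence.IsWeaklyRegular (Localization.AtPrime 𝔔.asIdeal) (List.ofFn s) ∧
              ∀ y : Localization.AtPrime 𝔔.asIdeal, (∃ e : ℕ, y ^ p ^ e ∈ Ideal.span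
                ((fun z : Localization.AtPrime 𝔔.asIdeal => z ^ p ^ e) '' (Ideal.span (Set.range s) : Set (Localization.AtPrime 𝔔.asIdeal)))) →
                y ∈ Ideal.span (Set.range s) :=
  originPointFixable_of_hon p k n t ht A hprim hAJ m hcov V hV a haA hgen hge f hf0 hprime hXne G d hθF hunit hv
    (hon_of_kernelChecks p k n t V G hg0 hX cells hcheck hSS)


/-- **`hon'` OF EVERY CHART FROM THE PER-CHART CELL PACKAGES** (the PHASE-1 theorems `chart<c>_cells` of the generated cells modules,
i.e. the conclusions of `KLocCellKit.klocCells_of_check`, collected over `c : Fin t`): with `g_c ≠ 0`, no variable dividing `g_c`, and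
the strata `SS c` covering every orthant over the centre, the hypothesis `hon'` of `pointFixable_of_ciCert` at `r = 1`,
`gs c = ![g_c]`. (So no per-chart `KLocCellRange` wrapper files are needed: the frame consumes the cell packages directly.) [folklore;
cite: Fedder1983, Prop. 1.7 and Thm. 1.12] -/
theorem hon_of_cells (p : ℕ) [Fact p.Prime] (k : Type) [Field k] [CharP k p] (n t : ℕ)
    (V : Fin t → Matrix (Fin n) (Fin n) ℕ) (G : Fin t → List (ℤ × (Fin n → ℕ)))
    (hg0 : ∀ c : Fin t, KLocCellKit.evalL k (G c) ≠ 0)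
    (hX : ∀ (c : Fin t) (i : Fin n), ¬ (X i : MvPolynomial (Fin n) k) ∣ KLocCellKit.evalL k (G c))
    (SS : Fin t → List (Finset (Fin n)))
    (hSS : ∀ (c : Fin t) (T : Finset (Fin n)), (∀ j ∈ (Finset.univ : Finset (Fin n)), ∃ i ∈ T, 0 < V c i j) →
      ∃ S ∈ SS c, S ⊆ T)
    (hcells : ∀ (c : Fin t), ∀ S ∈ SS c, ∃ (L : List ((Fin n →₀ ℕ) × MvPolynomial (Fin n) k)) (rr : List (MvPolynomial (Fin n) k))
        (tt : Fin n → MvPolynomial (Fin n) k) (t₀ : MvPolynomial (Fin n) k),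
        (L.map Prod.fst).Nodup ∧ (∀ e ∈ L, ∀ i : Fin n, e.1 i < p) ∧
        KLocCellKit.evalL k (G c) ^ (p - 1) = (L.map fun e => MvPolynomial.monomial e.1 (1 : k) * MvPolynomial.expand p e.2).sum ∧
        (1 : MvPolynomial (Fin n) k) = (List.zipWith (fun r e => r * MvPolynomial.expand p e.2) rr L).sum +
          ∑ i ∈ S, tt i * MvPolynomial.X i + t₀ * KLocCellKit.evalL k (G c)) :
    ∀ (c : Fin t) (Q' : Ideal (MvPolynomial (Fin n) k ⧸ Ideal.span (Set.range
        ((fun c : Fin t => (![KLocCellKit.evalL k (G c)] : Fin 1 → MvPolynomial (Fin n) k)) c)))) [Q'.IsMaximal],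
      (∀ j ∈ (Finset.univ : Finset (Fin n)), Ideal.Quotient.mk (Ideal.span (Set.range
          ((fun c : Fin t => (![KLocCellKit.evalL k (G c)] : Fin 1 → MvPolynomial (Fin n) k)) c)))
        (aeval (fun j : Fin n => ∏ i : Fin n, (X i : MvPolynomial (Fin n) k) ^ V c i j) (X j : MvPolynomial (Fin n) k)) ∈ Q') →
        (∀ i : Fin n, (X i : MvPolynomial (Fin n) k) ∈ Q'.comap (Ideal.Quotient.mk (Ideal.span (Set.range
            ((fun c : Fin t => (![KLocCellKit.evalL k (G c)] : Fin 1 → MvPolynomial (Fin n) k)) c)))) →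
          IsSMulRegular (Localization.AtPrime (Q'.comap (Ideal.Quotient.mk (Ideal.span (Set.range
              ((fun c : Fin t => (![KLocCellKit.evalL k (G c)] : Fin 1 → MvPolynomial (Fin n) k)) c))))) ⧸
              (Ideal.span (Set.range ((fun c : Fin t => (![KLocCellKit.evalL k (G c)] : Fin 1 → MvPolynomial (Fin n) k)) c))).map
                (algebraMap (MvPolynomial (Fin n) k)
                (Localization.AtPrime (Q'.comap (Ideal.Quotient.mk (Ideal.span (Set.range
                  ((fun c : Fin t => (![KLocCellKit.evalL k (G c)] : Fin 1 → MvPolynomial (Fin n) k)) c))))))))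
            (algebraMap (MvPolynomial (Fin n) k)
              (Localization.AtPrime (Q'.comap (Ideal.Quotient.mk (Ideal.span (Set.range
                ((fun c : Fin t => (![KLocCellKit.evalL k (G c)] : Fin 1 → MvPolynomial (Fin n) k)) c)))))) (X i))) ∧
        ∀ dd : ℕ, ringKrullDim (Localization.AtPrime Q') = dd → ∀ s : Fin dd → Localization.AtPrime Q',
          (Ideal.span (Set.range s)).radical.IsMaximal →
            RingTheory.Sequence.IsWeaklyRegular (Localization.AtPrime Q') (List.ofFn s) ∧
            ∀ y : Localization.AtPrime Q', (∃ e : ℕ, y ^ p ^ e ∈ Ideal.span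
              ((fun z : Localization.AtPrime Q' => z ^ p ^ e) ''
                (Ideal.span (Set.range s) : Set (Localization.AtPrime Q')))) → y ∈ Ideal.span (Set.range s) := by
  intro c
  exact KLocCellRange.honQuot_of_kLocCells_range p k n Finset.univ (V c) ![KLocCellKit.evalL k (G c)] (hg0 c) (hX c)
    (SS c) (hSS c) (hcells c)

/-- **THE ROAD-B FRAME, cell-package form.** For a hypersurface `X = V(f) ⊆ 𝔸ⁿ_k` through the origin (`f(0) = 0`, `(f)` prime, no `x̄ᵥ = 0`), the fan-side
binders of `CICertificates.ciCertificates` for a monomial centre `I_A` supported at the origin (`J = univ`) with `t > 0` unimodular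
charts (`hprim hAJ hcov hV haA hgen hge`), strict transforms `θ_{V c} f = Y^{d c} · g_c` with `g_c = KLocCellKit.evalL k (G c)`
(`hθF hunit`, `g_c ≠ 0`, `Y_i ∤ g_c`), vertices in the centre (`hv`), and per chart the CELL PACKAGES (`chart<c>_cells`, conclusions of
`KLocCellKit.klocCells_of_check`) on strata `SS c` covering every orthant over the centre ⟹ the origin of `X` is POINT-FIXABLE:
`∀ b, b.asIdeal = (x̄₁, …, x̄ₙ) → PFix_p(𝒪_{X,b})` (the `h0` shape of the specimen doors, hypersurface model). [folklore] -/
theorem originPointFixable_of_cells (p : ℕ) [Fact p.Prime] (k : Type) [Field k] [CharP k p] (n t : ℕ) (ht : 0 < t)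
    (A : Finset (Fin n →₀ ℕ)) (hprim : ∀ j ∈ (Finset.univ : Finset (Fin n)), ∃ N : ℕ, Finsupp.single j N ∈ A)
    (hAJ : ∀ a ∈ A, ∃ j ∈ (Finset.univ : Finset (Fin n)), 0 < a j)
    (m : Fin t → (Fin n →₀ ℕ))
    (hcov : ∀ a ∈ A, ∃ (c : Fin t) (K : ℕ), 1 ≤ K ∧ ∃ y ∈ (Ideal.span ((fun b : Fin n →₀ ℕ =>
        (MvPolynomial.monomial b (1 : k) : MvPolynomial (Fin n) k)) '' (A : Set (Fin n →₀ ℕ)))) ^ (K - 1),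
      (MvPolynomial.monomial a (1 : k) : MvPolynomial (Fin n) k) ^ K = MvPolynomial.monomial (m c) 1 * y)
    (V : Fin t → Matrix (Fin n) (Fin n) ℕ) (hV : ∀ c, IsUnit ((V c).map (Nat.cast : ℕ → ℤ)).det)
    (a : Fin t → Fin n → (Fin n →₀ ℕ)) (haA : ∀ c i, a c i ∈ A)
    (hgen : ∀ (c : Fin t) (i : Fin n), (Finsupp.equivFunOnFinite.symm ((V c).mulVec ⇑(a c i)) : Fin n →₀ ℕ) =
      Finsupp.equivFunOnFinite.symm ((V c).mulVec ⇑(m c)) + Finsupp.single i 1)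
    (hge : ∀ (c : Fin t), ∀ e ∈ A, (Finsupp.equivFunOnFinite.symm ((V c).mulVec ⇑(m c)) : Fin n →₀ ℕ) ≤
      Finsupp.equivFunOnFinite.symm ((V c).mulVec ⇑e))
    (f : MvPolynomial (Fin n) k) (hf0 : constantCoeff f = 0)
    (hprime : (Ideal.span (Set.range (![f] : Fin 1 → MvPolynomial (Fin n) k))).IsPrime)
    (hXne : ∀ v : Fin n, Ideal.Quotient.mk (Ideal.span (Set.range (![f] : Fin 1 → MvPolynomial (Fin n) k))) (MvPolynomial.X v) ≠ 0)
    (G : Fin t → List (ℤ × (Fin n → ℕ))) (d : Fin t → Fin 1 → (Fin n →₀ ℕ))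
    (hθF : ∀ c : Fin t, aeval (fun j : Fin n => ∏ i : Fin n, (X i : MvPolynomial (Fin n) k) ^ V c i j) f =
      monomial (d c 0) (1 : k) * KLocCellKit.evalL k (G c))
    (hunit : ∀ (c : Fin t) (l : Fin 1), ∃ (N : ℕ) (r' : Fin n →₀ ℕ), N • m c = ∑ j : Fin n, d c l j • a c j + r')
    (hv : ∀ c : Fin t, Ideal.Quotient.mk (Ideal.span (Set.range (![f] : Fin 1 → MvPolynomial (Fin n) k))) (monomial (m c) (1 : k)) ∈
      (Ideal.span ((fun e : Fin n →₀ ℕ => Ideal.Quotient.mk (Ideal.span (Set.range (![f] : Fin 1 → MvPolynomial (Fin n) k)))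
        (monomial e (1 : k))) '' (A : Set (Fin n →₀ ℕ)))))
    (hg0 : ∀ c : Fin t, KLocCellKit.evalL k (G c) ≠ 0)
    (hX : ∀ (c : Fin t) (i : Fin n), ¬ (X i : MvPolynomial (Fin n) k) ∣ KLocCellKit.evalL k (G c))
    (SS : Fin t → List (Finset (Fin n)))
    (hSS : ∀ (c : Fin t) (T : Finset (Fin n)), (∀ j ∈ (Finset.univ : Finset (Fin n)), ∃ i ∈ T, 0 < V c i j) →
      ∃ S ∈ SS c, S ⊆ T)
    (hcells : ∀ (c : Fin t), ∀ S ∈ SS c, ∃ (L : List ((Fin n →₀ ℕ) × MvPolynomial (Fin n) k)) (rr : List (MvPolynomial (Fin n) k))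
        (tt : Fin n → MvPolynomial (Fin n) k) (t₀ : MvPolynomial (Fin n) k),
        (L.map Prod.fst).Nodup ∧ (∀ e ∈ L, ∀ i : Fin n, e.1 i < p) ∧
        KLocCellKit.evalL k (G c) ^ (p - 1) = (L.map fun e => MvPolynomial.monomial e.1 (1 : k) * MvPolynomial.expand p e.2).sum ∧
        (1 : MvPolynomial (Fin n) k) = (List.zipWith (fun r e => r * MvPolynomial.expand p e.2) rr L).sum +
          ∑ i ∈ S, tt i * MvPolynomial.X i + t₀ * KLocCellKit.evalL k (G c)) :
    ∀ b : Spec (.of (MvPolynomial (Fin n) k ⧸ Ideal.span (Set.range (![f] : Fin 1 → MvPolynomial (Fin n) k)))),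
      b.asIdeal = Ideal.span (Set.range fun j : Fin n =>
        Ideal.Quotient.mk (Ideal.span (Set.range (![f] : Fin 1 → MvPolynomial (Fin n) k))) (X j)) →
      ∃ (nc : ℕ) (c : Fin nc → (Spec (.of (MvPolynomial (Fin n) k ⧸ Ideal.span (Set.range (![f] : Fin 1 → MvPolynomial (Fin n) k))))).presheaf.stalk b),
        Ideal.span (Set.range c) ≠ ⊥ ∧ (Ideal.span (Set.range c)).radical =
          IsLocalRing.maximalIdeal ((Spec (.of (MvPolynomial (Fin n) k ⧸ Ideal.span (Set.range (![f] : Fin 1 → MvPolynomial (Fin n) k))))).presheaf.stalk b) ∧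
        ∀ (j : Fin nc) (𝔔 : PrimeSpectrum (Literature.AlgebraicGeometry.Resolution.blowupAlgebra (Ideal.span (Set.range c)) (c j))),
          𝔔.asIdeal.comap (algebraMap ((Spec (.of (MvPolynomial (Fin n) k ⧸ Ideal.span (Set.range (![f] : Fin 1 → MvPolynomial (Fin n) k))))).presheaf.stalk b)
            (Literature.AlgebraicGeometry.Resolution.blowupAlgebra (Ideal.span (Set.range c)) (c j))) =
            IsLocalRing.maximalIdeal ((Spec (.of (MvPolynomial (Fin n) k ⧸ Ideal.span (Set.range (![f] : Fin 1 → MvPolynomial (Fin n) k))))).presheaf.stalk b) →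
          IsDomain (Localization.AtPrime 𝔔.asIdeal) ∧ ∀ dd : ℕ, ringKrullDim (Localization.AtPrime 𝔔.asIdeal) = dd →
            ∀ s : Fin dd → Localization.AtPrime 𝔔.asIdeal, (Ideal.span (Set.range s)).radical.IsMaximal →
              RingTheory.Sequence.IsWeaklyRegular (Localization.AtPrime 𝔔.asIdeal) (List.ofFn s) ∧
              ∀ y : Localization.AtPrime 𝔔.asIdeal, (∃ e : ℕ, y ^ p ^ e ∈ Ideal.span
                ((fun z : Localization.AtPrime 𝔔.asIdeal => z ^ p ^ e) '' (Ideal.span (Set.range s) : Set (Localization.AtPrime 𝔔.asIdeal)))) →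
                y ∈ Ideal.span (Set.range s) :=
  originPointFixable_of_hon p k n t ht A hprim hAJ m hcov V hV a haA hgen hge f hf0 hprime hXne G d hθF hunit hv
    (hon_of_cells p k n t V G hg0 hX SS hSS hcells)

/-! ## Re-ordering the chart polynomial's term list (two generated text sets: key-sorted vs JSON order) -/
/-- `KLocCellKit.evalL` is invariant under permutations of the term list. [folklore] -/
theorem evalL_eq_of_perm (k : Type) [Field k] {n : ℕ} {L₁ L₂ : List (ℤ × (Fin n → ℕ))} (h : L₁.Perm L₂) :
    KLocCellKit.evalL k L₁ = KLocCellKit.evalL k L₂ := by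
  unfold KLocCellKit.evalL
  exact (h.map _).sum_eq

/-- **Transport of a chart's cell package along an equality of chart polynomials** (the package depends on `g` only through its
value). [folklore] -/
theorem cells_of_eq (p : ℕ) (k : Type) [Field k] {n : ℕ} (SS : List (Finset (Fin n))) {g₁ g₂ : MvPolynomial (Fin n) k}
    (hg : g₁ = g₂)
    (h : ∀ S ∈ SS, ∃ (L : List ((Fin n →₀ ℕ) × MvPolynomial (Fin n) k)) (rr : List (MvPolynomial (Fin n) k))
        (tt : Fin n → MvPolynomial (Fin n) k) (t₀ : MvPolynomial (Fin n) k),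
        (L.map Prod.fst).Nodup ∧ (∀ e ∈ L, ∀ i : Fin n, e.1 i < p) ∧
        g₁ ^ (p - 1) = (L.map fun e => MvPolynomial.monomial e.1 (1 : k) * MvPolynomial.expand p e.2).sum ∧
        (1 : MvPolynomial (Fin n) k) = (List.zipWith (fun r e => r * MvPolynomial.expand p e.2) rr L).sum +
          ∑ i ∈ S, tt i * MvPolynomial.X i + t₀ * g₁) :
    ∀ S ∈ SS, ∃ (L : List ((Fin n →₀ ℕ) × MvPolynomial (Fin n) k)) (rr : List (MvPolynomial (Fin n) k))
        (tt : Fin n → MvPolynomial (Fin n) k) (t₀ : MvPolynomial (Fin n) k),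
        (L.map Prod.fst).Nodup ∧ (∀ e ∈ L, ∀ i : Fin n, e.1 i < p) ∧
        g₂ ^ (p - 1) = (L.map fun e => MvPolynomial.monomial e.1 (1 : k) * MvPolynomial.expand p e.2).sum ∧
        (1 : MvPolynomial (Fin n) k) = (List.zipWith (fun r e => r * MvPolynomial.expand p e.2) rr L).sum +
          ∑ i ∈ S, tt i * MvPolynomial.X i + t₀ * g₂ := by
  subst hg
  exact h

/-- **A chart's cell package for a PERMUTED term list**: the generated `chart<c>_cells` theorem over a term list `G₁` yields the
package over any permutation `G₂` of it (e.g. the key-sorted text set vs the JSON-order table `T11Char7Poly.G c`; the permutation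
side-goal closes by `decide +kernel`). [folklore] -/
theorem cells_of_perm (p : ℕ) (k : Type) [Field k] {n : ℕ} (SS : List (Finset (Fin n))) {G₁ G₂ : List (ℤ × (Fin n → ℕ))}
    (hG : G₁.Perm G₂)
    (h : ∀ S ∈ SS, ∃ (L : List ((Fin n →₀ ℕ) × MvPolynomial (Fin n) k)) (rr : List (MvPolynomial (Fin n) k))
        (tt : Fin n → MvPolynomial (Fin n) k) (t₀ : MvPolynomial (Fin n) k),
        (L.map Prod.fst).Nodup ∧ (∀ e ∈ L, ∀ i : Fin n, e.1 i < p) ∧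
        KLocCellKit.evalL k G₁ ^ (p - 1) = (L.map fun e => MvPolynomial.monomial e.1 (1 : k) * MvPolynomial.expand p e.2).sum ∧
        (1 : MvPolynomial (Fin n) k) = (List.zipWith (fun r e => r * MvPolynomial.expand p e.2) rr L).sum +
          ∑ i ∈ S, tt i * MvPolynomial.X i + t₀ * KLocCellKit.evalL k G₁) :
    ∀ S ∈ SS, ∃ (L : List ((Fin n →₀ ℕ) × MvPolynomial (Fin n) k)) (rr : List (MvPolynomial (Fin n) k))
        (tt : Fin n → MvPolynomial (Fin n) k) (t₀ : MvPolynomial (Fin n) k),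
        (L.map Prod.fst).Nodup ∧ (∀ e ∈ L, ∀ i : Fin n, e.1 i < p) ∧
        KLocCellKit.evalL k G₂ ^ (p - 1) = (L.map fun e => MvPolynomial.monomial e.1 (1 : k) * MvPolynomial.expand p e.2).sum ∧
        (1 : MvPolynomial (Fin n) k) = (List.zipWith (fun r e => r * MvPolynomial.expand p e.2) rr L).sum +
          ∑ i ∈ S, tt i * MvPolynomial.X i + t₀ * KLocCellKit.evalL k G₂ :=
  cells_of_eq p k SS (evalL_eq_of_perm k hG) h


/-- **Transport of a cell package along a strata-list equality AND a term-list permutation** (per-chart form of the instance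
files; `hS`/`hG` by `decide +kernel`, so the elaborator never unfolds the chart tables). [folklore] -/
theorem cells_transport (p : ℕ) (k : Type) [Field k] {n : ℕ} {SS₁ SS₂ : List (Finset (Fin n))} {G₁ G₂ : List (ℤ × (Fin n → ℕ))}
    (hS : SS₁ = SS₂) (hG : G₁.Perm G₂)
    (h : ∀ S ∈ SS₁, ∃ (L : List ((Fin n →₀ ℕ) × MvPolynomial (Fin n) k)) (rr : List (MvPolynomial (Fin n) k))
        (tt : Fin n → MvPolynomial (Fin n) k) (t₀ : MvPolynomial (Fin n) k),
        (L.map Prod.fst).Nodup ∧ (∀ e ∈ L, ∀ i : Fin n, e.1 i < p) ∧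
        KLocCellKit.evalL k G₁ ^ (p - 1) = (L.map fun e => MvPolynomial.monomial e.1 (1 : k) * MvPolynomial.expand p e.2).sum ∧
        (1 : MvPolynomial (Fin n) k) = (List.zipWith (fun r e => r * MvPolynomial.expand p e.2) rr L).sum +
          ∑ i ∈ S, tt i * MvPolynomial.X i + t₀ * KLocCellKit.evalL k G₁) :
    ∀ S ∈ SS₂, ∃ (L : List ((Fin n →₀ ℕ) × MvPolynomial (Fin n) k)) (rr : List (MvPolynomial (Fin n) k))
        (tt : Fin n → MvPolynomial (Fin n) k) (t₀ : MvPolynomial (Fin n) k),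
        (L.map Prod.fst).Nodup ∧ (∀ e ∈ L, ∀ i : Fin n, e.1 i < p) ∧
        KLocCellKit.evalL k G₂ ^ (p - 1) = (L.map fun e => MvPolynomial.monomial e.1 (1 : k) * MvPolynomial.expand p e.2).sum ∧
        (1 : MvPolynomial (Fin n) k) = (List.zipWith (fun r e => r * MvPolynomial.expand p e.2) rr L).sum +
          ∑ i ∈ S, tt i * MvPolynomial.X i + t₀ * KLocCellKit.evalL k G₂ := by
  subst hS
  exact cells_of_perm p k _ hG h

end Summit.ResolutionOfSingularities.ResolutionOfSingularities.Theorems.FInjectiveMacaulayfication.RoadBFrame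

end
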